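import Summits.Ventures.PercRepro.GenQSevenFiveCorners
import Summits.Ventures.PercRepro.GenQOpenLayersCore

/-!
# PercRepro — the three corners of `(7, 5)` on CORE matroids (night-4, gen 2)

`sevenFiveLayers_of_corners` (`GenQSevenFiveCorners.lean`) splits the type-`4` layer of `(7, 5)` on simple matroids into the
corners (i) «hyperplane + one point», (ii) «hyperplane + two points», (iii) the rest, and `rls_seven_five_of_layersCore`
(`GenQOpenLayersCore.lean`) lands the row from the layers on Core matroids of rank `7` only.  This file restates the corners
with `Core M 7` in place of `Simple M` — every line of such a matroid has `≤ 3` points, its rank-`4` traces and rank-`5`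
flats are bounded (`card_add_one_le_two_pow_of_core`) and every point is `e`-free — and composes them to
`SevenFiveLayersCore`, hence to `RLS M 7 5` on every finite matroid (`rls_seven_five_of_cornersCore`).  The Core-typed
corners are the statements to prove (or to check by certificate on the finitely many shapes they allow); the simple-matroid
corners imply them (`sevenFiveCornerOneCore_of_cornerOne`, …).
-/

namespace PercRepro.GenQ

open Finset ThmH PerFlat SixFour ThmN NightThree

/-- **Corner (i) on the core**: «hyperplane + one point» at `(7, 5)`, `t = 4`, on rank-`4` traces of Core matroids of
rank `7`. -/
def SevenFiveCornerOneCore : Prop :=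
  ∀ {β : Type} [DecidableEq β] (M : Matroid β) [M.Finite] (H : Finset β), Core M 7 → H ⊆ gr M →
    M.eRk (H : Set β) = 4 → 0 ≤ ∑ B ∈ Rq M H 4, (3 / (2 + (mTr M B : ℚ)) - (7 / 6) * dem M H 4 B)

/-- **Corner (ii) on the core**: «hyperplane + two points» at `(7, 5)`, `t = 4`, as the profile inequality of the
trace, on Core matroids of rank `7`. -/
def SevenFiveCornerTwoCore : Prop :=
  ∀ {β : Type} [DecidableEq β] (M : Matroid β) [M.Finite] (τ : Finset β) (a a' : β), Core M 7 → τ ⊆ gr M →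
    a ∈ gr M → a' ∈ gr M → a ≠ a' → a ∉ τ → a' ∉ τ → a ∉ M.closure (τ : Set β) → a' ∉ M.closure (τ : Set β) →
    M.eRk (τ : Set β) = 4 → M.eRk ((insert a (insert a' τ) : Finset β) : Set β) = 5 →
    0 ≤ hypAddTwoProfile M τ a a' 4 4

/-- **Corner (iii) on the core**: the type-`4` balance on the rank-`5` flats in `𝔉_5` of Core matroids of rank `7`
with no hyperplane trace of `≥ g − 2` points. -/
def SevenFiveCornerThreeCore : Prop :=
  ∀ {β : Type} [DecidableEq β] (M : Matroid β) [M.Finite] (G : Finset β), Core M 7 → G ∈ flatsQ M 5 →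
    TwoHyp M G 5 → ¬ HypPlusLeTwo M G 5 → 0 ≤ Jq M G 5 4

/-- The type-`2` window and the type-`3` layer of `(7, 5)` on Core matroids of rank `7`. -/
def SevenFiveLowLayersCore : Prop :=
  ∀ {β : Type} [DecidableEq β] (M : Matroid β) [M.Finite] (G : Finset β), Core M 7 → G ∈ flatsQ M 5 →
    TwoHyp M G 5 → (G.card ≤ 10 → 0 ≤ Jq M G 5 2) ∧ 0 ≤ Jq M G 5 3

/-- The simple-matroid corner (i) implies its Core form. -/
theorem sevenFiveCornerOneCore_of_cornerOne (h : SevenFiveCornerOne) : SevenFiveCornerOneCore := by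
  intro β _ M _ H hc hH hr
  exact h M H (simple_of_core hc) hH hr

/-- The simple-matroid corner (ii) implies its Core form. -/
theorem sevenFiveCornerTwoCore_of_cornerTwo (h : SevenFiveCornerTwo) : SevenFiveCornerTwoCore := by
  intro β _ M _ τ a a' hc hτ ha ha' hne haτ ha'τ hacl ha'cl hrτ hrG
  exact h M τ a a' (simple_of_core hc) hτ ha ha' hne haτ ha'τ hacl ha'cl hrτ hrG

/-- The simple-matroid corner (iii) implies its Core form. -/
theorem sevenFiveCornerThreeCore_of_cornerThree (h : SevenFiveCornerThree) : SevenFiveCornerThreeCore := by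
  intro β _ M _ G hc hG hF hH
  exact h M G (simple_of_core hc) hG hF hH

/-- The simple-matroid low layers imply their Core form. -/
theorem sevenFiveLowLayersCore_of_lowLayers (h : SevenFiveLowLayers) : SevenFiveLowLayersCore := by
  intro β _ M _ G hc hG hF
  exact h M G (simple_of_core hc) hG hF

/-- **The `(7, 5)` layers on the core from the three Core-typed corners and the Core-typed low layers**
(the proof of `sevenFiveLayers_of_corners`, with `Core M 7` carried along). -/
theorem sevenFiveLayersCore_of_cornersCore (h1 : SevenFiveCornerOneCore) (h2 : SevenFiveCornerTwoCore)
    (h3 : SevenFiveCornerThreeCore) (hlow : SevenFiveLowLayersCore) : SevenFiveLayersCore := by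
  intro β _ M _ G hc hG hF
  refine ⟨(hlow M G hc hG hF).1, (hlow M G hc hG hF).2, ?_⟩
  have hGg : G ⊆ gr M := (mem_flatsQ.1 hG).1
  have hr : M.eRk (G : Set β) = 5 := by
    have := (mem_flatsQ.1 hG).2.2
    exact_mod_cast this
  by_cases hH : HypPlusLeTwo M G 5
  · rcases hypPlusLeTwo_cases hr hH with ⟨a, haG, hra⟩ | ⟨a, haG, a', ha'G, hne, hrτ, hacl, ha'cl⟩
    · -- corner (i)
      have ha : a ∈ gr M := hGg haG
      have hacl : a ∉ M.closure ((G.erase a : Finset β) : Set β) :=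
        notMem_closure_erase_of_eRk_lt ha (by rw [hra, hr]; norm_num)
      have key := Jq_five_four_hyp_add_one_eq (M := M) (H := G.erase a) ha (Finset.notMem_erase a G) hacl hra
      rw [Finset.insert_erase haG] at key
      rw [key]
      exact h1 M (G.erase a) hc ((Finset.erase_subset a G).trans hGg) hra
    · -- corner (ii)
      have ha : a ∈ gr M := hGg haG
      have ha' : a' ∈ gr M := hGg ha'G
      have haτ : a ∉ (G.erase a).erase a' := fun h => (Finset.mem_erase.1 (Finset.mem_of_mem_erase h)).1 rfl
      have ha'τ : a' ∉ (G.erase a).erase a' := fun h => (Finset.mem_erase.1 h).1 rfl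
      have hins : insert a (insert a' ((G.erase a).erase a')) = G := by
        rw [Finset.insert_erase (Finset.mem_erase.2 ⟨fun h => hne h.symm, ha'G⟩), Finset.insert_erase haG]
      have hτg : (G.erase a).erase a' ⊆ gr M :=
        ((Finset.erase_subset _ _).trans (Finset.erase_subset _ _)).trans hGg
      have hrτ' : M.eRk (((G.erase a).erase a' : Finset β) : Set β) = ((4 : ℕ) : ℕ∞) := by
        rw [hrτ]; rfl
      have hrG : M.eRk ((insert a (insert a' ((G.erase a).erase a')) : Finset β) : Set β) = ((4 : ℕ) : ℕ∞) + 1 := by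
        rw [hins, hr]; rfl
      have key := Jq_hyp_add_two_ge_profile (M := M) (q := 4) (t := 4) ha ha' hne haτ ha'τ hacl ha'cl hrτ' hrG
        (by norm_num) (by norm_num)
      rw [hins] at key
      refine le_trans ?_ key
      exact h2 M ((G.erase a).erase a') a a' hc hτg ha ha' hne haτ ha'τ hacl ha'cl hrτ (by rw [hins, hr])
  · exact h3 M G hc hG hF hH

/-- **C-025 at `(7, 5)` on every finite matroid from the Core-typed corners and low layers.** -/
theorem rls_seven_five_of_cornersCore {α : Type} [DecidableEq α] (h1 : SevenFiveCornerOneCore)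
    (h2 : SevenFiveCornerTwoCore) (h3 : SevenFiveCornerThreeCore) (hlow : SevenFiveLowLayersCore) (M : Matroid α)
    [M.Finite] : RLS M 7 5 :=
  rls_seven_five_of_layersCore (sevenFiveLayersCore_of_cornersCore h1 h2 h3 hlow) M

end PercRepro.GenQ
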